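import Summits.Schanuel.Schanuel.Theses.RigidCore

/-!
# W-free lemmas for the split of `RigidCore.SparsityTwo` (part 2)

Helpers for the line `cusp-germ-schneider-sparsity` of the crux `RigidCore.SparsityTwo`
(item stmt-Schanuel-0971): the shifted Runge lemma (a jet that is a rational polynomial in `N` PLUS A
CONSTANT with infinitely many integer points forces the tail `g ≡ 0` near `0`), the ray points
`σ_N = N^{-1/e}` (limit, membership in punctured discs, `(N^{1/e})^e = N`), the linear-jet normal form
`A = β X^e + a₀` (a polynomial in `σ⁻¹` matching a germ continuous at `0` is constant), algebraicity of the
Taylor coefficients of the regular part `G` of a linear jet (via the arithmetic normal form, passed as a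
hypothesis `hANF1` = first half of the landed `stub_taylorLogCoeffsAlgebraic`) and of the defect germ
`Φ = β(ℓ₀ - ℓ₀ 0) - (ℓ₁ - ℓ₁ 0) + G`, the order of a non-flat analytic germ, and the ℚ-dependence of
torsion lattice translates. Moved verbatim from the lead's skeleton
(`Cruxes/SparsityTwo/Lines/cusp_germ_schneider_sparsity.lean`, gens 0/c1). Mathlib only; no unproved facts.
-/

set_option linter.dupNamespace false

namespace Summit.Schanuel.Schanuel.Cruxes.SparsityTwo.CuspGermSchneiderSparsity

open Filter Topology Complex Polynomial Literature.NumberTheory.Transcendental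
open scoped Real

/-- Clearing denominators: `b · q(N)` is an integer polynomial value for some `b ≠ 0`. [folklore] -/
theorem exists_int_mul_ratPoly_eval_eq (q : Polynomial ℚ) :
    ∃ b : ℤ, b ≠ 0 ∧ ∃ P : Polynomial ℤ, ∀ N : ℕ,
      (b : ℂ) * (q.map (algebraMap ℚ ℂ)).eval (N : ℂ) = ((P.eval (N : ℤ) : ℤ) : ℂ) := by
  obtain ⟨b, hb, hP⟩ := IsLocalization.integerNormalization_spec (nonZeroDivisors ℤ) q
  refine ⟨b, nonZeroDivisors.ne_zero hb, IsLocalization.integerNormalization (nonZeroDivisors ℤ) q,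
    fun N => ?_⟩
  have h1 : ((b • q).map (algebraMap ℚ ℂ)).eval (N : ℂ) =
      (b : ℂ) * (q.map (algebraMap ℚ ℂ)).eval (N : ℂ) := by
    rw [zsmul_eq_mul, Polynomial.map_mul, Polynomial.map_intCast, Polynomial.eval_mul,
      Polynomial.eval_intCast]
  rw [← h1, ← hP, Polynomial.map_map, Polynomial.eval_map, Polynomial.eval₂_at_natCast, eq_intCast]

/-- **Theorem R with a constant shift.** If `g` is analytic at `0` with `g 0 = 0`, the sample
points `t N` tend to `0` avoiding `0`, and `q(N) + c + g(t N) ∈ ℤ` for infinitely many `N`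
(`q ∈ ℚ[X]`, `c ∈ ℂ` arbitrary), then `g ≡ 0` near `0`. Proof: with `b q(N) ∈ ℤ`, the numbers
`u_N := b (c + g(t N))` are integers at hits and converge to `b c` along `atTop`; two integers within
`1/4` of the same complex number coincide, so `g (t N)` takes ONE value `κ` at all large hits; as
`g (t N) → 0` along the (infinite) hit set, `κ = 0`; the identity theorem concludes. [folklore] -/
theorem eventually_zero_of_infinite_shifted_hits {q : Polynomial ℚ} {c : ℂ} {g : ℂ → ℂ}
    {t : ℕ → ℂ} (hg : AnalyticAt ℂ g 0) (hg0 : g 0 = 0) (ht : Tendsto t atTop (𝓝[≠] 0))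
    (hinf : Set.Infinite {N : ℕ | ∃ L : ℤ,
      (q.map (algebraMap ℚ ℂ)).eval (N : ℂ) + c + g (t N) = L}) :
    ∀ᶠ z in 𝓝 (0 : ℂ), g z = 0 := by
  have ht0 : Tendsto t atTop (𝓝 0) := ht.mono_right nhdsWithin_le_nhds
  obtain ⟨b, hb, P, hP⟩ := exists_int_mul_ratPoly_eval_eq q
  -- `g (t N) → 0`
  have hg' : Tendsto (fun N => g (t N)) atTop (𝓝 0) := by
    have h := hg.continuousAt.tendsto.comp ht0
    rwa [hg0] at h
  -- `b * (c + g (t N)) → b * c`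
  have hbg : Tendsto (fun N => (b : ℂ) * (c + g (t N))) atTop (𝓝 ((b : ℂ) * c)) := by
    have := (hg'.const_add c).const_mul (b : ℂ)
    simpa using this
  have hsmall : ∀ᶠ N in atTop, ‖(b : ℂ) * (c + g (t N)) - (b : ℂ) * c‖ < 1 / 4 := by
    have h := (hbg.sub_const ((b : ℂ) * c)).norm
    rw [sub_self, norm_zero] at h
    exact h.eventually (gt_mem_nhds (by norm_num))
  -- at a hit, `b * (c + g (t N))` is an integer
  have hint : ∀ N : ℕ, (∃ L : ℤ, (q.map (algebraMap ℚ ℂ)).eval (N : ℂ) + c + g (t N) = L) →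
      ∃ M : ℤ, (b : ℂ) * (c + g (t N)) = M := by
    rintro N ⟨L, hL⟩
    refine ⟨b * L - P.eval (N : ℤ), ?_⟩
    have h2 : (b : ℂ) * (c + g (t N)) = b * L - (b : ℂ) * (q.map (algebraMap ℚ ℂ)).eval (N : ℂ) := by
      rw [← hL]; ring
    rw [h2, hP N]; push_cast; ring
  -- the hits are frequent
  have hfreq : ∃ᶠ N : ℕ in atTop,
      ∃ L : ℤ, (q.map (algebraMap ℚ ℂ)).eval (N : ℂ) + c + g (t N) = L :=
    Nat.frequently_atTop_iff_infinite.mpr hinf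
  -- pick one large hit `N₀`; every other large hit has the same value of `g ∘ t`
  obtain ⟨N₀, hN₀small, hN₀hit⟩ := (hsmall.and_frequently hfreq).exists
  obtain ⟨M₀, hM₀⟩ := hint N₀ hN₀hit
  have hconst : ∀ᶠ N : ℕ in atTop,
      (∃ L : ℤ, (q.map (algebraMap ℚ ℂ)).eval (N : ℂ) + c + g (t N) = L) →
        g (t N) = g (t N₀) := by
    filter_upwards [hsmall] with N hN hhit
    obtain ⟨M, hM⟩ := hint N hhit
    have hdist : ‖((M : ℂ)) - (M₀ : ℂ)‖ < 1 := by
      have h1 : ‖(b : ℂ) * (c + g (t N)) - (b : ℂ) * c‖ < 1 / 4 := hN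
      have h2 : ‖(b : ℂ) * (c + g (t N₀)) - (b : ℂ) * c‖ < 1 / 4 := hN₀small
      rw [hM] at h1
      rw [hM₀] at h2
      calc ‖(M : ℂ) - (M₀ : ℂ)‖ = ‖((M : ℂ) - (b : ℂ) * c) - ((M₀ : ℂ) - (b : ℂ) * c)‖ := by ring_nf
        _ ≤ ‖(M : ℂ) - (b : ℂ) * c‖ + ‖(M₀ : ℂ) - (b : ℂ) * c‖ := norm_sub_le _ _
        _ < 1 / 4 + 1 / 4 := add_lt_add h1 h2
        _ < 1 := by norm_num
    have hMM : M = M₀ := by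
      have : |(M - M₀ : ℤ)| < 1 := by
        rw [← Int.cast_sub, Complex.norm_intCast] at hdist
        exact_mod_cast hdist
      linarith [Int.abs_lt_one_iff.mp this]
    have hbne : (b : ℂ) ≠ 0 := Int.cast_ne_zero.mpr hb
    have : (b : ℂ) * (c + g (t N)) = (b : ℂ) * (c + g (t N₀)) := by rw [hM, hM₀, hMM]
    have := mul_left_cancel₀ hbne this
    exact add_left_cancel this
  -- the common value is `0`, because `g (t N) → 0` along the infinite hit set
  have hκ : g (t N₀) = 0 := by
    by_contra hne
    have hpos : 0 < ‖g (t N₀)‖ := norm_pos_iff.mpr hne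
    have hev : ∀ᶠ N in atTop, ‖g (t N)‖ < ‖g (t N₀)‖ := by
      have h := hg'.norm
      rw [norm_zero] at h
      exact h.eventually (gt_mem_nhds hpos)
    obtain ⟨N, ⟨hN1, hN2⟩, hN3⟩ := ((hev.and hconst).and_frequently hfreq).exists
    have := hN2 hN3
    rw [this] at hN1
    exact lt_irrefl _ hN1
  have hzero : ∀ᶠ N : ℕ in atTop,
      (∃ L : ℤ, (q.map (algebraMap ℚ ℂ)).eval (N : ℂ) + c + g (t N) = L) → g (t N) = 0 := by
    filter_upwards [hconst] with N hN hhit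
    rw [hN hhit, hκ]
  have hfreq0 : ∃ᶠ z in 𝓝[≠] (0 : ℂ), g z = 0 := ht.frequently (hfreq.mp hzero)
  exact hg.frequently_zero_iff_eventually_zero.mp hfreq0

/-- The ray points `σ_N = (N^{1/e})⁻¹` (`e ≥ 1`) tend to `0` within `{0}ᶜ`. [folklore] -/
theorem tendsto_rayPoint_nhdsNE {e : ℕ} (he : 0 < e) :
    Tendsto (fun N : ℕ => ((((N : ℝ) ^ ((e : ℝ)⁻¹) : ℝ) : ℂ))⁻¹) atTop (𝓝[≠] 0) := by
  have hpos : (0 : ℝ) < (e : ℝ)⁻¹ := inv_pos.mpr (by exact_mod_cast he)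
  have h1 : Tendsto (fun N : ℕ => (N : ℝ) ^ ((e : ℝ)⁻¹)) atTop atTop :=
    (tendsto_rpow_atTop hpos).comp tendsto_natCast_atTop_atTop
  have h2 : Tendsto (fun N : ℕ => ((((N : ℝ) ^ ((e : ℝ)⁻¹) : ℝ) : ℂ))⁻¹) atTop (𝓝 0) := by
    have h3 := (Complex.continuous_ofReal.tendsto 0).comp h1.inv_tendsto_atTop
    rw [Complex.ofReal_zero] at h3
    refine Tendsto.congr (fun N => ?_) h3
    simp only [Function.comp_apply, Pi.inv_apply, Complex.ofReal_inv]
  refine tendsto_nhdsWithin_iff.mpr ⟨h2, ?_⟩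
  filter_upwards [eventually_gt_atTop 0] with N hN
  exact inv_ne_zero
    (Complex.ofReal_ne_zero.mpr (Real.rpow_pos_of_pos (Nat.cast_pos.mpr hN) _).ne')

/-- **Theorem R, shifted, on the ray.** If `e ≥ 1`, `q ∈ ℚ[X]`, `c ∈ ℂ`, `g` analytic at `0` with
`g 0 = 0`, and `q(N) + c + g(N^{-1/e}) ∈ ℤ` for infinitely many `N : ℕ`, then `g ≡ 0` near `0`.
[folklore] -/
theorem rationalJetShift_eventually_zero :
    ∀ (e : ℕ), 0 < e → ∀ (q : Polynomial ℚ) (c : ℂ) (g : ℂ → ℂ), AnalyticAt ℂ g 0 → g 0 = 0 →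
      Set.Infinite {N : ℕ | ∃ L : ℤ,
        (q.map (algebraMap ℚ ℂ)).eval (N : ℂ) + c + g ((((N : ℝ) ^ ((e : ℝ)⁻¹) : ℝ) : ℂ))⁻¹ = L} →
      ∀ᶠ z in 𝓝 (0 : ℂ), g z = 0 :=
  fun _e he _q _c _g hg hg0 hinf =>
    eventually_zero_of_infinite_shifted_hits hg hg0 (tendsto_rayPoint_nhdsNE he) hinf

/-- The ray abscissa `w N = N^{1/e}` satisfies `(w N)^e = N`. [folklore] -/
theorem rayAbscissa_pow {e : ℕ} (he : 0 < e) (N : ℕ) :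
    ((((N : ℝ) ^ ((e : ℝ)⁻¹) : ℝ) : ℂ)) ^ e = (N : ℂ) := by
  rw [← Complex.ofReal_pow, Real.rpow_inv_natCast_pow (Nat.cast_nonneg N) he.ne']
  simp

/-- A polynomial in `σ⁻¹` that agrees near `σ = 0` with a function continuous at `0` is constant.
[folklore] -/
theorem natDegree_eq_zero_of_eval_inv_eq {Q : Polynomial ℂ} {Ψ : ℂ → ℂ} (hΨ : ContinuousAt Ψ 0)
    (h : ∀ᶠ σ in 𝓝[≠] (0 : ℂ), Q.eval σ⁻¹ = Ψ σ) : Q.natDegree = 0 := by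
  by_contra hne
  have hdeg : 0 < Q.degree := by
    rw [Polynomial.degree_eq_natDegree (by rintro rfl; simp at hne)]
    exact_mod_cast Nat.pos_of_ne_zero hne
  -- `‖Q(σ⁻¹)‖ → ∞` along `σ → 0`, `σ ≠ 0`
  have h1 : Tendsto (fun σ : ℂ => ‖Q.eval σ⁻¹‖) (𝓝[≠] 0) atTop :=
    Q.tendsto_norm_atTop hdeg
      (tendsto_norm_cobounded_atTop.comp Filter.tendsto_inv₀_nhdsNE_zero)
  have h2 : Tendsto (fun σ : ℂ => ‖Ψ σ‖) (𝓝[≠] 0) atTop :=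
    h1.congr' (h.mono fun σ hσ => by rw [hσ])
  have h3 : Tendsto (fun σ : ℂ => ‖Ψ σ‖) (𝓝[≠] 0) (𝓝 ‖Ψ 0‖) :=
    (hΨ.norm.tendsto).mono_left nhdsWithin_le_nhds
  exact not_tendsto_atTop_of_tendsto_nhds h3 h2

/-- The punctured disc `0 < ‖σ‖ < ρ` is a punctured neighbourhood of `0`. [folklore] -/
theorem puncturedDisc_mem_nhdsNE {ρ : ℝ} (hρ : 0 < ρ) :
    {σ : ℂ | 0 < ‖σ‖ ∧ ‖σ‖ < ρ} ∈ 𝓝[≠] (0 : ℂ) := by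
  have h1 : Metric.ball (0 : ℂ) ρ ∈ 𝓝 (0 : ℂ) := Metric.ball_mem_nhds 0 hρ
  have h2 : {σ : ℂ | σ ≠ 0} ∈ 𝓝[≠] (0 : ℂ) := self_mem_nhdsWithin
  filter_upwards [mem_nhdsWithin_of_mem_nhds h1, h2] with σ hσ hσ0
  exact ⟨norm_pos_iff.mpr hσ0, by simpa using hσ⟩

/-- The ray points `σ_N = (w N)⁻¹` eventually lie in every punctured disc. [folklore] -/
theorem eventually_rayPoint_mem_puncturedDisc {e : ℕ} (he : 0 < e) {ρ : ℝ} (hρ : 0 < ρ) :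
    ∀ᶠ N : ℕ in atTop, 0 < ‖((((N : ℝ) ^ ((e : ℝ)⁻¹) : ℝ) : ℂ))⁻¹‖ ∧
      ‖((((N : ℝ) ^ ((e : ℝ)⁻¹) : ℝ) : ℂ))⁻¹‖ < ρ :=
  (tendsto_rayPoint_nhdsNE he).eventually (puncturedDisc_mem_nhdsNE hρ)


/-- **Linear-jet normal form.** If a polynomial jet `A(σ⁻¹)` differs from `β σ⁻ᵉ` by a germ continuous at `0` on a
punctured neighbourhood of `0`, then `A = β X^e + a₀` with `a₀ = (A - β X^e).coeff 0`. [folklore] -/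
theorem jet_eq_of_eval_inv_sub {A : Polynomial ℂ} {β : ℂ} {e : ℕ} {Ψ : ℂ → ℂ} (hΨ : ContinuousAt Ψ 0)
    (h : ∀ᶠ σ in 𝓝[≠] (0 : ℂ), A.eval σ⁻¹ - β * σ⁻¹ ^ e = Ψ σ) :
    ∃ a₀ : ℂ, A = Polynomial.C β * Polynomial.X ^ e + Polynomial.C a₀ := by
  set Q : Polynomial ℂ := A - Polynomial.C β * Polynomial.X ^ e with hQ
  have hQΨ : ∀ᶠ σ in 𝓝[≠] (0 : ℂ), Q.eval σ⁻¹ = Ψ σ := by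
    filter_upwards [h] with σ hσ
    simpa only [hQ, Polynomial.eval_sub, Polynomial.eval_mul, Polynomial.eval_C, Polynomial.eval_pow,
      Polynomial.eval_X] using hσ
  have hQdeg : Q.natDegree = 0 := natDegree_eq_zero_of_eval_inv_eq hΨ hQΨ
  have hQC : Q = Polynomial.C (Q.coeff 0) := Polynomial.eq_C_of_natDegree_eq_zero hQdeg
  refine ⟨Q.coeff 0, ?_⟩
  have hA : A = Q + Polynomial.C β * Polynomial.X ^ e := by rw [hQ]; ring
  rw [hA, add_comm, ← hQC]

/-- **Taylor coefficients of the regular part of a linear jet are algebraic.** If `Φ₁ t / t^{N₀} = β t⁻ᵉ + G t` on a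
punctured disc, `β ∈ ℚ̄`, `G` analytic at `0`, and `(t⁻ᵉ, Φ₁ t/t^{N₀})` satisfies a non-zero rational relation `R₃` there,
then every `G⁽ⁿ⁾(0)` is algebraic: `G` solves the `ℚ̄`-relation `R₃(X, βX + Y)`, to which the ANF (first half of
`stub_taylorLogCoeffsAlgebraic`, passed as `hANF1`) applies. [folklore] -/
theorem isAlgebraic_iteratedDeriv_of_linearJet
    (hANF1 : ∀ (Φ : ℂ → ℂ) (e N : ℕ) (R : MvPolynomial (Fin 2) ℂ), 0 < e → AnalyticAt ℂ Φ 0 → R ≠ 0 →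
      (∀ m, IsAlgebraic ℚ (R.coeff m)) →
      (∀ᶠ t in 𝓝[≠] (0 : ℂ), MvPolynomial.eval ![(t ^ e)⁻¹, Φ t / t ^ N] R = 0) →
      ∀ n : ℕ, IsAlgebraic ℚ (iteratedDeriv n Φ 0))
    {e N₀ : ℕ} (he : 0 < e) {Φ₁ G : ℂ → ℂ} (hG : AnalyticAt ℂ G 0) {β : ℂ} (hβalg : IsAlgebraic ℚ β)
    {r : ℝ} (hr : 0 < r) {R₃ : MvPolynomial (Fin 2) ℚ} (hR₃0 : R₃ ≠ 0)
    (hR₃ : ∀ t : ℂ, 0 < ‖t‖ → ‖t‖ < r → MvPolynomial.aeval ![(t ^ e)⁻¹, Φ₁ t / t ^ N₀] R₃ = 0)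
    (hjet : ∀ t : ℂ, 0 < ‖t‖ → ‖t‖ < r → Φ₁ t / t ^ N₀ = β * (t ^ e)⁻¹ + G t) :
    ∀ n : ℕ, IsAlgebraic ℚ (iteratedDeriv n G 0) := by
  obtain ⟨b, hb⟩ : ∃ b : ↥(algebraicClosure ℚ ℂ), (b : ℂ) = β :=
    ⟨⟨β, mem_algebraicClosure_iff.mpr hβalg⟩, rfl⟩
  set RA : MvPolynomial (Fin 2) ↥(algebraicClosure ℚ ℂ) :=
    MvPolynomial.map (algebraMap ℚ ↥(algebraicClosure ℚ ℂ)) R₃ with hRA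
  set φ : MvPolynomial (Fin 2) ↥(algebraicClosure ℚ ℂ) →ₐ[↥(algebraicClosure ℚ ℂ)]
      MvPolynomial (Fin 2) ↥(algebraicClosure ℚ ℂ) :=
    MvPolynomial.aeval ![MvPolynomial.X 0, MvPolynomial.C b * MvPolynomial.X 0 + MvPolynomial.X 1]
    with hφ
  set ψ : MvPolynomial (Fin 2) ↥(algebraicClosure ℚ ℂ) →ₐ[↥(algebraicClosure ℚ ℂ)]
      MvPolynomial (Fin 2) ↥(algebraicClosure ℚ ℂ) :=
    MvPolynomial.aeval ![MvPolynomial.X 0, -MvPolynomial.C b * MvPolynomial.X 0 + MvPolynomial.X 1]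
    with hψ
  have hψφ : ψ.comp φ = AlgHom.id _ _ := by
    apply MvPolynomial.algHom_ext
    intro i
    fin_cases i
    · simp [hφ, hψ]
    · simp [hφ, hψ]; ring
  have hRA0 : RA ≠ 0 := fun h =>
    hR₃0 (MvPolynomial.map_injective _ (algebraMap ℚ ↥(algebraicClosure ℚ ℂ)).injective
      (by rw [← hRA, h, map_zero]))
  have hφ0 : φ RA ≠ 0 := by
    intro h
    apply hRA0
    have h' := congrArg ψ h
    rwa [← AlgHom.comp_apply, hψφ, AlgHom.id_apply, map_zero] at h'
  set RC : MvPolynomial (Fin 2) ℂ := MvPolynomial.map (algebraMap ↥(algebraicClosure ℚ ℂ) ℂ) (φ RA)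
    with hRC
  have hRC0 : RC ≠ 0 := fun h =>
    hφ0 (MvPolynomial.map_injective _ (algebraMap ↥(algebraicClosure ℚ ℂ) ℂ).injective
      (by rw [← hRC, h, map_zero]))
  have hRCalg : ∀ m, IsAlgebraic ℚ (RC.coeff m) := fun m => by
    rw [hRC, MvPolynomial.coeff_map]
    exact mem_algebraicClosure_iff.mp (SetLike.coe_mem _)
  have hRCrel : ∀ᶠ t in 𝓝[≠] (0 : ℂ), MvPolynomial.eval ![(t ^ e)⁻¹, G t / t ^ 0] RC = 0 := by
    filter_upwards [puncturedDisc_mem_nhdsNE hr] with t ht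
    rw [pow_zero, div_one, hRC, MvPolynomial.eval_map, ← MvPolynomial.aeval_def, hφ,
      ← AlgHom.comp_apply, MvPolynomial.comp_aeval, hRA, MvPolynomial.aeval_map_algebraMap]
    have hfun : (fun i => MvPolynomial.aeval ![(t ^ e)⁻¹, G t]
        ((![MvPolynomial.X 0, MvPolynomial.C b * MvPolynomial.X 0 + MvPolynomial.X 1] :
          Fin 2 → MvPolynomial (Fin 2) ↥(algebraicClosure ℚ ℂ)) i)) =
        ![(t ^ e)⁻¹, Φ₁ t / t ^ N₀] := by
      funext i
      fin_cases i
      · simp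
      · simp [hjet t ht.1 ht.2, ← hb]
    rw [hfun]
    exact hR₃ t ht.1 ht.2
  exact hANF1 G e 0 RC he hG hRC0 hRCalg hRCrel

/-- **Taylor coefficients of the defect germ** `Φ = β(ℓ₀ - ℓ₀ 0) - (ℓ₁ - ℓ₁ 0) + G` are algebraic when `β`, the positive-order
coefficients of `ℓ₀, ℓ₁` and all coefficients of `G` are. [folklore] -/
theorem isAlgebraic_iteratedDeriv_defectGerm {β : ℂ} {ℓ₀ ℓ₁ G : ℂ → ℂ} (h₀ : AnalyticAt ℂ ℓ₀ 0)
    (h₁ : AnalyticAt ℂ ℓ₁ 0) (hG : AnalyticAt ℂ G 0) (hβalg : IsAlgebraic ℚ β)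
    (hℓ₀alg : ∀ n : ℕ, 0 < n → IsAlgebraic ℚ (iteratedDeriv n ℓ₀ 0))
    (hℓ₁alg : ∀ n : ℕ, 0 < n → IsAlgebraic ℚ (iteratedDeriv n ℓ₁ 0))
    (hGalg : ∀ n : ℕ, IsAlgebraic ℚ (iteratedDeriv n G 0)) (n : ℕ) :
    IsAlgebraic ℚ (iteratedDeriv n (fun t => β * (ℓ₀ t - ℓ₀ 0) - (ℓ₁ t - ℓ₁ 0) + G t) 0) := by
  rcases Nat.eq_zero_or_pos n with rfl | hn
  · simpa using hGalg 0
  · have c₀ : ContDiffAt ℂ n (fun t => ℓ₀ t - ℓ₀ 0) 0 := (h₀.sub analyticAt_const).contDiffAt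
    have c₀' : ContDiffAt ℂ n (fun t => β * (ℓ₀ t - ℓ₀ 0)) 0 :=
      (analyticAt_const.mul (h₀.sub analyticAt_const)).contDiffAt
    have c₁ : ContDiffAt ℂ n (fun t => ℓ₁ t - ℓ₁ 0) 0 := (h₁.sub analyticAt_const).contDiffAt
    have c₀₁ : ContDiffAt ℂ n (fun t => β * (ℓ₀ t - ℓ₀ 0) - (ℓ₁ t - ℓ₁ 0)) 0 := c₀'.sub c₁
    have cG : ContDiffAt ℂ n G 0 := hG.contDiffAt
    rw [iteratedDeriv_fun_add c₀₁ cG, iteratedDeriv_fun_sub c₀' c₁,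
      iteratedDeriv_const_mul β c₀, iteratedDeriv_fun_sub h₀.contDiffAt contDiffAt_const,
      iteratedDeriv_fun_sub h₁.contDiffAt contDiffAt_const, iteratedDeriv_const,
      iteratedDeriv_const, if_neg hn.ne', if_neg hn.ne', sub_zero, sub_zero]
    exact ((hβalg.mul (hℓ₀alg n hn)).sub (hℓ₁alg n hn)).add (hGalg n)

/-- **The order of a non-flat analytic germ.** If `Φ` is analytic at `0` and not identically zero near `0`, it has a
least `k` with `Φ⁽ᵏ⁾(0) ≠ 0` (Taylor: all coefficients zero would make `Φ ≡ 0` on a ball). [folklore] -/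
theorem exists_order_of_not_eventually_zero {Φ : ℂ → ℂ} (hΦan : AnalyticAt ℂ Φ 0)
    (hΦne : ¬ ∀ᶠ z in 𝓝 (0 : ℂ), Φ z = 0) :
    ∃ k : ℕ, (∀ i : ℕ, i < k → iteratedDeriv i Φ 0 = 0) ∧ iteratedDeriv k Φ 0 ≠ 0 := by
  classical
  have hex : ∃ k : ℕ, iteratedDeriv k Φ 0 ≠ 0 := by
    by_contra hall
    push Not at hall
    apply hΦne
    obtain ⟨ε, hε, hanal⟩ := hΦan.exists_ball_analyticOnNhd
    have hdiff : DifferentiableOn ℂ Φ (Metric.ball 0 ε) := hanal.differentiableOn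
    filter_upwards [Metric.ball_mem_nhds (0 : ℂ) hε] with z hz
    rw [← Complex.taylorSeries_eq_on_ball' hz hdiff]
    simp [hall]
  refine ⟨Nat.find hex, fun i hi => ?_, Nat.find_spec hex⟩
  have h := Nat.find_min hex hi
  push Not at h
  exact h

/-- **Both cusp values torsion, exponential coordinates constant: late hits are ℚ-dependent.** With `q ℓⱼ = 2πi mⱼ` the
lattice translate `(ℓ₀ + 2πi N, ℓ₁ + 2πi L)` has both coordinates in `2πi ℚ`; for `q N + m₀ ≠ 0` it is ℚ-linearly
dependent. [folklore] -/
theorem not_linearIndependent_torsion_translate {q : ℕ} (hq : 0 < q) {m₀ m₁ : ℤ} {l₀ l₁ : ℂ}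
    (hm₀ : (q : ℂ) * l₀ = m₀ * (2 * ↑π * I)) (hm₁ : (q : ℂ) * l₁ = m₁ * (2 * ↑π * I)) {N L : ℤ}
    (hN : (q : ℤ) * N + m₀ ≠ 0) :
    ¬ LinearIndependent ℚ ![l₀ + 2 * ↑π * I * (N : ℂ), l₁ + 2 * ↑π * I * (L : ℂ)] := by
  intro hind
  have hqC : (q : ℂ) ≠ 0 := Nat.cast_ne_zero.mpr hq.ne'
  have hℓ₀0 : l₀ = m₀ * (2 * ↑π * I) / q := by rw [← hm₀]; field_simp
  have hℓ₁0 : l₁ = m₁ * (2 * ↑π * I) / q := by rw [← hm₁]; field_simp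
  rw [LinearIndependent.pair_iff] at hind
  have key := hind ((q : ℚ) * L + m₁) (-((q : ℚ) * N + m₀)) (by
    simp only [Rat.smul_def]
    push_cast
    rw [hℓ₀0, hℓ₁0]
    field_simp
    ring)
  have h2 := key.2
  rw [neg_eq_zero] at h2
  exact hN (by exact_mod_cast h2)


/-! ## Appended (lead c2, 2026-08-16): the linear-jet normal form (moved here from the split, W-free) -/

/-- **Linear-jet normal form of the σ-side jet.** If the cusp point at `σ` is the `t`-branch point at `T σ`
(linking identities) and the `t`-jet is linear, `Φ₁ t/t^{N₀} = β t⁻ᵉ + G t`, then `A = β X^e + a₀`: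
`A(σ⁻¹) - β σ⁻ᵉ = (β ℓu σ + G(T σ) - 2πi g σ - ℓv σ)/(2πi)` is continuous at `0`. [folklore] -/
theorem linearJet_normalForm {e N₀ : ℕ} {A : Polynomial ℂ} {g ℓu ℓv T ℓ₀ ℓ₁ Φ₁ G : ℂ → ℂ} {ρ r : ℝ}
    {β : ℂ} (hρ : 0 < ρ) (hg : AnalyticAt ℂ g 0) (hu : AnalyticAt ℂ ℓu 0) (hv : AnalyticAt ℂ ℓv 0)
    (hT : AnalyticAt ℂ T 0) (hT0 : T 0 = 0) (hG : AnalyticAt ℂ G 0)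
    (hlink : ∀ σ : ℂ, 0 < ‖σ‖ → ‖σ‖ < ρ → 0 < ‖T σ‖ ∧ ‖T σ‖ < r ∧
      ((T σ) ^ e)⁻¹ = 2 * ↑π * I * σ⁻¹ ^ e + ℓu σ ∧
      Φ₁ (T σ) / (T σ) ^ N₀ = 2 * ↑π * I * (A.eval σ⁻¹ + g σ) + ℓv σ ∧
      ℓ₀ (T σ) = ℓu σ ∧ ℓ₁ (T σ) = ℓv σ)
    (hjet : ∀ t : ℂ, 0 < ‖t‖ → ‖t‖ < r → Φ₁ t / t ^ N₀ = β * (t ^ e)⁻¹ + G t) :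
    ∃ a₀ : ℂ, A = Polynomial.C β * Polynomial.X ^ e + Polynomial.C a₀ := by
  have h2pi : (2 * (π : ℂ) * I) ≠ 0 := by simp [Real.pi_ne_zero, I_ne_zero]
  have hjetσ : ∀ σ : ℂ, 0 < ‖σ‖ → ‖σ‖ < ρ →
      2 * ↑π * I * (A.eval σ⁻¹ + g σ) + ℓv σ = β * (2 * ↑π * I * σ⁻¹ ^ e + ℓu σ) + G (T σ) := by
    intro σ hσ1 hσ2
    obtain ⟨hT1, hT2, h3, h4, -, -⟩ := hlink σ hσ1 hσ2
    rw [← h4, ← h3]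
    exact hjet _ hT1 hT2
  set Ψ : ℂ → ℂ := fun σ =>
    (β * ℓu σ + G (T σ) - 2 * ↑π * I * g σ - ℓv σ) / (2 * ↑π * I) with hΨ
  have hAΨ : ∀ᶠ σ in 𝓝[≠] (0 : ℂ), A.eval σ⁻¹ - β * σ⁻¹ ^ e = Ψ σ := by
    filter_upwards [puncturedDisc_mem_nhdsNE hρ] with σ hσ
    have hj := hjetσ σ hσ.1 hσ.2
    rw [hΨ, eq_div_iff h2pi]
    linear_combination hj
  have hΨc : ContinuousAt Ψ 0 := by
    have hGT : ContinuousAt (fun σ => G (T σ)) 0 :=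
      ContinuousAt.comp_of_eq hG.continuousAt hT.continuousAt hT0
    simp only [hΨ]
    exact ((((continuousAt_const.mul hu.continuousAt).add hGT).sub
      (continuousAt_const.mul hg.continuousAt)).sub hv.continuousAt).div_const _
  exact jet_eq_of_eval_inv_sub hΨc hAΨ

/-- Coefficient and degree of the linear-jet normal form `A = C β * X^e + C a₀` (`e ≥ 1`): `A.coeff e = β` and
`A.natDegree ≤ e`. [folklore] -/
theorem coeff_natDegree_of_eq_C_mul_X_pow_add_C {A : Polynomial ℂ} {β a₀ : ℂ} {e : ℕ} (he : 0 < e)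
    (hA : A = Polynomial.C β * Polynomial.X ^ e + Polynomial.C a₀) : A.coeff e = β ∧ A.natDegree ≤ e := by
  refine ⟨?_, ?_⟩
  · rw [hA, Polynomial.coeff_add, Polynomial.coeff_C_mul, Polynomial.coeff_X_pow_self, Polynomial.coeff_C,
      if_neg he.ne']
    ring
  · rw [hA]
    refine (Polynomial.natDegree_add_le _ _).trans (max_le ?_ ?_)
    · exact Polynomial.natDegree_C_mul_X_pow_le β e
    · simp

end Summit.Schanuel.Schanuel.Cruxes.SparsityTwo.CuspGermSchneiderSparsity
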